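import Literature.MathematicalPhysics.QuantumManyBody.BoseGasThermodynamicLimitRuelle
import HarnessLib

/-!
# Ruelle 1969, §3.5.11: `m` bosons in `m` separated unit cells cost at most `m E₀^D(1, 1)`

Topic `Literature/MathematicalPhysics/QuantumManyBody`, a companion of
`BoseGasThermodynamicLimitRuelle.lean` ([Ruelle1969, §3.5.11]: subadditivity of the Dirichlet
ground-state energy of a finite-range repulsive Bose gas under merging of states with
`R`-separated supports, `infEnergy_union_le` / `infEnergy_biUnion_le`).

Content (all proved):

* `infEnergy_subBox_le_groundStateEnergy` — a cell `subBox ℓ p d` (a translate of the open cube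
  `Λ_ℓ`) is as good as the cube: `E(n, subBox ℓ p d) ≤ E₀^D(n, ℓ)` (`infEnergy_translate_le`,
  `groundStateEnergy_eq_infEnergy`);
* `infEnergy_iUnion_subBox_le` — **padding states**: for a measurable `v ≥ 0` vanishing beyond
  `R ≥ 0` and `m` unit cells `subBox 1 (1 + R) (d j)` at distinct lattice sites `d j ∈ ℕ³`
  (pitch `1 + R`, so that distinct cells are `R`-separated), one particle per cell gives
  `E(m, ⋃ⱼ cell_j) ≤ m · E₀^D(1, 1)` (`infEnergy_biUnion_le` with `n ≡ 1`). This is the form in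
  which Ruelle's subadditivity is used to pad a trial state with extra particles at bounded cost
  per particle (`E₀^D(1, 1) < ∞`, `groundStateEnergy_one_lt_top`), e.g. to adjust the particle
  number of a localised torus state to a prescribed density (crux line `reward-pays-the-wall` of
  `AtomisticToContinuum/BoseEinsteinCondensation`).

## References

* [Ruelle1969] D. Ruelle, *Statistical Mechanics: Rigorous Results* (Benjamin, 1969), §3.5.11
  (merging of Dirichlet states with disjoint supports; subadditivity of the ground-state energy).
-/

noncomputable section

open MeasureTheory
open scoped ENNReal NNReal

namespace Literature.MathematicalPhysics.QuantumManyBody.BoseGas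

/-- A cell is a translate of the cube: `E(n, subBox ℓ p d) ≤ E₀^D(n, ℓ)`
(`subBox ℓ p d = {x | x - a ∈ Λ_ℓ}` definitionally). [cite: Ruelle1969, §3.5.11] -/
theorem infEnergy_subBox_le_groundStateEnergy (v : ℝ → ℝ≥0∞) (n : ℕ) (ℓ p : ℝ)
    (d : Fin 3 → ℕ) : infEnergy v n (subBox ℓ p d) ≤ groundStateEnergy v n ℓ := by
  rw [groundStateEnergy_eq_infEnergy]
  exact infEnergy_translate_le v n (box ℓ) _

/-- **Padding states (subadditivity over separated unit cells).** For a measurable `v ≥ 0`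
vanishing beyond `R ≥ 0` and `m` unit cells `subBox 1 (1 + R) (d j)` at distinct lattice sites,
`E(m, ⋃ⱼ cell_j) ≤ m · E₀^D(1, 1)` (one particle per cell: `infEnergy_biUnion_le` with `n ≡ 1`,
then `infEnergy_subBox_le_groundStateEnergy`). [cite: Ruelle1969, §3.5.11] -/
theorem infEnergy_iUnion_subBox_le (v : ℝ → ℝ≥0∞) (R : ℝ) (hv : Measurable v)
    (hv0 : ∀ r, R < r → v r = 0) (hR : 0 ≤ R) (m : ℕ) (d : Fin m → Fin 3 → ℕ)
    (hd : Function.Injective d) :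
    infEnergy v m (⋃ j, subBox 1 (1 + R) (d j)) ≤ m * groundStateEnergy v 1 1 := by
  classical
  have h := infEnergy_biUnion_le (ℓ := 1) hv hv0 hR Finset.univ d
    (fun c _ c' _ hne h => hne (hd h)) (fun _ => 1)
  simp only [Finset.sum_const, Finset.card_univ, Fintype.card_fin, smul_eq_mul, mul_one,
    Finset.mem_univ, Set.iUnion_true] at h
  refine h.trans ?_
  calc ∑ c : Fin m, infEnergy v 1 (subBox 1 (1 + R) (d c))
      ≤ ∑ _c : Fin m, groundStateEnergy v 1 1 :=
        Finset.sum_le_sum fun c _ => infEnergy_subBox_le_groundStateEnergy v 1 1 (1 + R) (d c)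
    _ = m * groundStateEnergy v 1 1 := by
        rw [Finset.sum_const, Finset.card_univ, Fintype.card_fin, nsmul_eq_mul]

end Literature.MathematicalPhysics.QuantumManyBody.BoseGas

end
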